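import Summits.MatrixMultiplication.MatrixMultiplication.Theorems.SoloInformedCwTwoNurmievThreeCharTwo
import Summits.MatrixMultiplication.MatrixMultiplication.Theorems.SoloInformedNullconeHasse
import HarnessLib

/-!
# The multiplier-`2` nullcone edges `N₁→N₉`, `N₃→N₆`, `N₅→N₇` hold in characteristic `2`
(solo-informed, gen 27)

`SoloInformedNullconeHasse` lands 38 covering degenerations among Nurmiev's 24 nilpotent orbits of
`K³ ⊗ K³ ⊗ K³`; 33 of the certificates have multiplier `D = 1` (valid over every commutative ring)
and five — `N₁→N₉, N₃→N₆, N₃→N₈, N₃→N₉, N₅→N₇` — have `D = 2`, so that they were known only over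
rings in which `2` is a unit.  Here the three edges `N₁→N₉`, `N₃→N₆`, `N₅→N₇` are settled in
characteristic `2` as well: SAT search (kissat on the native `𝔽₂` encoding of
`(A ⊗ B ⊗ C)·N_k ≡ ε^h N_l (mod ε^(h+1), 2)`, jobs j197157–j197159, each solved in seconds) found
order-`2` certificates MODULO `2`, verified independently and checked below by the kernel through
`DegenCert.checkMod` (`SoloInformedCwTwoNurmievThreeCharTwo`).  Consequently these three edges hold
over EVERY FIELD (`nullcone_three_covers_field`).

**`N₃` and `N₆` coincide modulo `2`.**  The constant parts of the `N₃→N₆` certificate are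
unimodular: with `A₀ = B₀ = (0,1,0; 1,1,0; 1,1,1)`, `C₀ = (1,0,0; 1,1,1; 0,0,1) ∈ GL₃(ℤ)` one has
`(A₀ ⊗ B₀ ⊗ C₀)·N₃ ≡ N₆ (mod 2)` EXACTLY (order-`0` certificates `nurmiev_3_6_mod2_check0`,
`nurmiev_6_3_mod2_check0`), so over every commutative ring with `2 = 0` Nurmiev's integral normal
forms `N₃` and `N₆` degenerate to each other (`nurmiev_three_six_equiv_of_two_eq_zero`) — over a
field of characteristic `2` they lie in the same `GL₃³`-orbit, although over `ℂ` the orbit of `N₃`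
(dimension `22`) strictly contains that of `N₆` (dimension `21`) in its closure.  Consequently
characteristic `2` CREATES relations that fail over `ℂ`: `N₆ ⊵ N₃`, `N₄ ⊵ N₃` (and gives cheap
proofs of `N₂ ⊵ N₃`, `N₁ ⊵ N₃`), `char_two_relations_above_three`; and `T_{cw,2} ⊵ N₃` in
characteristic `2` (`SoloInformedCwTwoNurmievThreeCharTwo`) is re-explained as
`T_{cw,2} ⊵ N₆ ≅ N₃`.

The remaining two multiplier-`2` edges genuinely depend on the characteristic: over a field with
`2 = 0` one has `T_{cw,2} ⊵ N₃` (`cwTensor_two_polyDegeneratesTo_nurmiev_three_of_two_eq_zero`)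
while `T_{cw,2} ⋭ N₈` (paper Theorem H, a lattice argument over the dual numbers) and
`T_{cw,2} ⋭ N₉` (pencil cubic: `ℓ·m²` does not degenerate to three concurrent lines), so
`N₃ ⋭ N₈` and `N₃ ⋭ N₉` in characteristic `2` — those two non-degenerations are paper statements,
not asserted here. [cite: Nurmiev2000, Table 2]
-/

namespace Summit.MatrixMultiplication.MatrixMultiplication.Theorems.NullconeHasse
open Literature.Computability.AlgebraicComplexity
open Literature.Barriers.MatrixMultiplication (PolyDegeneratesTo)
open Summit.MatrixMultiplication.MatrixMultiplication.Theorems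

/-- `N₁ ⊵ N₉` at order `2` MODULO `2` (kissat, job j197159; verified independently).
[cite: Nurmiev2000, Table 2] -/
theorem nurmiev_1_9_mod2_check :
    DegenCert.checkMod 2 3 3 3 3 3 3 2 (nurmievInt 1) (nurmievInt 9)
      ![![[1, 1], [0, 1, 1], []], ![[1, 1, 1], [0, 0, 1], []], ![[1, 1, 1], [], []]]
      ![![[0, 1], [1, 0, 1], [1]], ![[0, 1], [1, 1], [1]], ![[0, 1, 1], [1], [1]]]
      ![![[1], [1, 1, 1], [1, 0, 1]], ![[], [1, 1], [1, 1]], ![[0, 1, 1], [1], [1, 1]]]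
      = true := by
  decide +kernel

/-- `N₃ ⊵ N₆` at order `2` MODULO `2` (kissat, job j197157; verified independently).  Note that
`A = ε²·A₀` here, so modulo `2` the class `N₆` is even a RESTRICTION `(A₀ ⊗ B(0) ⊗ C(0))·N₃`.
[cite: Nurmiev2000, Table 2] -/
theorem nurmiev_3_6_mod2_check :
    DegenCert.checkMod 2 3 3 3 3 3 3 2 (nurmievInt 3) (nurmievInt 6)
      ![![[], [0, 0, 1], []], ![[0, 0, 1], [0, 0, 1], []], ![[0, 0, 1], [0, 0, 1], [0, 0, 1]]]
      ![![[], [1], [0, 1]], ![[1], [1], []], ![[1], [1, 1], [1]]]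
      ![![[1], [], []], ![[1, 0, 1], [1], [1, 0, 1]], ![[], [], [1]]]
      = true := by
  decide +kernel

/-- `N₅ ⊵ N₇` at order `2` MODULO `2` (kissat, job j197158; verified independently).
[cite: Nurmiev2000, Table 2] -/
theorem nurmiev_5_7_mod2_check :
    DegenCert.checkMod 2 3 3 3 3 3 3 2 (nurmievInt 5) (nurmievInt 7)
      ![![[0, 1], [], []], ![[1], [], [0, 1]], ![[0, 1], [0, 1, 1], []]]
      ![![[1, 1], [], []], ![[], [0, 1, 1], []], ![[1], [1, 1], [0, 1]]]
      ![![[1, 0, 1], [], []], ![[], [0, 1], []], ![[1, 1, 1], [], [0, 1, 1]]]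
      = true := by
  decide +kernel

/-- **`N₃ ≡ N₆ (mod 2)`, forward direction at order `0`**: `(A₀ ⊗ B₀ ⊗ C₀)·N₃ ≡ N₆ (mod 2)`
with `A₀ = B₀ = (0,1,0; 1,1,0; 1,1,1)`, `C₀ = (1,0,0; 1,1,1; 0,0,1)`, all in `GL₃(ℤ)` (the constant
parts of `nurmiev_3_6_mod2_check`). [cite: Nurmiev2000, Table 2] -/
theorem nurmiev_3_6_mod2_check0 :
    DegenCert.checkMod 2 3 3 3 3 3 3 0 (nurmievInt 3) (nurmievInt 6)
      ![![[], [1], []], ![[1], [1], []], ![[1], [1], [1]]]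
      ![![[], [1], []], ![[1], [1], []], ![[1], [1], [1]]]
      ![![[1], [], []], ![[1], [1], [1]], ![[], [], [1]]]
      = true := by
  decide +kernel

/-- **`N₃ ≡ N₆ (mod 2)`, backward direction at order `0`**: the inverse matrices modulo `2`,
`A₀⁻¹ = B₀⁻¹ ≡ (1,1,0; 1,0,0; 0,1,1)`, `C₀⁻¹ ≡ C₀`. [cite: Nurmiev2000, Table 2] -/
theorem nurmiev_6_3_mod2_check0 :
    DegenCert.checkMod 2 3 3 3 3 3 3 0 (nurmievInt 6) (nurmievInt 3)
      ![![[1], [1], []], ![[1], [], []], ![[], [1], [1]]]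
      ![![[1], [1], []], ![[1], [], []], ![[], [1], [1]]]
      ![![[1], [], []], ![[1], [1], [1]], ![[], [], [1]]]
      = true := by
  decide +kernel

/-- **Nurmiev's classes `N₃` and `N₆` degenerate to each other over every commutative ring of
characteristic `2`** (they are one `GL₃³`-orbit over any field with `2 = 0`; over `ℂ`, `N₆ ⋭ N₃`).
[cite: Nurmiev2000, Table 2] -/
theorem nurmiev_three_six_equiv_of_two_eq_zero (K : Type*) [CommRing K] (h2 : (2 : K) = 0) :
    PolyDegeneratesTo (nurmiev K 3) (nurmiev K 6) ∧ PolyDegeneratesTo (nurmiev K 6) (nurmiev K 3) :=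
  ⟨DegenCert.polyDegeneratesTo_of_checkMod K (p := 2) (by exact_mod_cast h2) nurmiev_3_6_mod2_check0,
    DegenCert.polyDegeneratesTo_of_checkMod K (p := 2) (by exact_mod_cast h2) nurmiev_6_3_mod2_check0⟩

/-- **Relations created by characteristic `2`**: over every commutative ring with `2 = 0`,
`N₆ ⊵ N₃`, `N₄ ⊵ N₃`, `N₂ ⊵ N₃`, `N₁ ⊵ N₃` (through `N₆`; the first two FAIL over `ℂ`, where
`dim GL₃³·N₃ = 22 > 21 = dim GL₃³·N₆` and `N₄ ⋭ N₃` by semicontinuous ranks).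
[cite: Nurmiev2000, Table 2] -/
theorem char_two_relations_above_three (K : Type*) [CommRing K] (h2 : (2 : K) = 0) :
    PolyDegeneratesTo (nurmiev K 6) (nurmiev K 3) ∧
    PolyDegeneratesTo (nurmiev K 4) (nurmiev K 3) ∧
    PolyDegeneratesTo (nurmiev K 2) (nurmiev K 3) ∧
    PolyDegeneratesTo (nurmiev K 1) (nurmiev K 3) := by
  have h63 := (nurmiev_three_six_equiv_of_two_eq_zero K h2).2
  obtain ⟨h14, -, h26, -, -, h46, -⟩ := nullcone_covers_ring K
  exact ⟨h63, h46.trans h63, h26.trans h63, h14.trans (h46.trans h63)⟩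

/-- **`N₁ ⊵ N₉`, `N₃ ⊵ N₆`, `N₅ ⊵ N₇` over every commutative ring of characteristic `2`.**
[cite: Nurmiev2000, Table 2] -/
theorem nullcone_three_covers_of_two_eq_zero (K : Type*) [CommRing K] (h2 : (2 : K) = 0) :
    PolyDegeneratesTo (nurmiev K 1) (nurmiev K 9) ∧
    PolyDegeneratesTo (nurmiev K 3) (nurmiev K 6) ∧
    PolyDegeneratesTo (nurmiev K 5) (nurmiev K 7) :=
  ⟨DegenCert.polyDegeneratesTo_of_checkMod K (p := 2) (by exact_mod_cast h2) nurmiev_1_9_mod2_check,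
    DegenCert.polyDegeneratesTo_of_checkMod K (p := 2) (by exact_mod_cast h2) nurmiev_3_6_mod2_check,
    DegenCert.polyDegeneratesTo_of_checkMod K (p := 2) (by exact_mod_cast h2) nurmiev_5_7_mod2_check⟩

/-- **The three edges `N₁ ⊵ N₉`, `N₃ ⊵ N₆`, `N₅ ⊵ N₇` hold over EVERY field** (multiplier-`2`
certificates when `2 ≠ 0`, the certificates modulo `2` when `2 = 0`). [cite: Nurmiev2000, Table 2] -/
theorem nullcone_three_covers_field (K : Type*) [Field K] :
    PolyDegeneratesTo (nurmiev K 1) (nurmiev K 9) ∧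
    PolyDegeneratesTo (nurmiev K 3) (nurmiev K 6) ∧
    PolyDegeneratesTo (nurmiev K 5) (nurmiev K 7) := by
  rcases eq_or_ne (2 : K) 0 with h2 | h2
  · exact nullcone_three_covers_of_two_eq_zero K h2
  · obtain ⟨h19, h36, -, -, h57⟩ := nullcone_covers_of_two_ne_zero K h2
    exact ⟨h19, h36, h57⟩

/-- The same three edges over every commutative ring in which `2 = 0` or `2` is a unit (e.g. every
`ℤ[1/2]`-algebra and every `𝔽₂`-algebra). [cite: Nurmiev2000, Table 2] -/
theorem nullcone_three_covers_of_two_eq_zero_or_isUnit (K : Type*) [CommRing K]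
    (h2 : (2 : K) = 0 ∨ IsUnit (2 : K)) :
    PolyDegeneratesTo (nurmiev K 1) (nurmiev K 9) ∧
    PolyDegeneratesTo (nurmiev K 3) (nurmiev K 6) ∧
    PolyDegeneratesTo (nurmiev K 5) (nurmiev K 7) := by
  rcases h2 with h2 | h2
  · exact nullcone_three_covers_of_two_eq_zero K h2
  · obtain ⟨h19, h36, -, -, h57⟩ :=
      nullcone_covers_of_isUnit_two K (by rw [Int.cast_ofNat]; exact h2)
    exact ⟨h19, h36, h57⟩

/-- **A degeneration chain living entirely in characteristic `2`: `T_{cw,2} ⊵ N₃ ⊵ N₆ ⊵ N₇`** over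
every commutative ring with `2 = 0` (the first link fails over `ℚ`, the second was previously known
only when `2` is a unit). [cite: Nurmiev2000, Table 2] -/
theorem cwTensor_two_chain_of_two_eq_zero (K : Type*) [CommRing K] (h2 : (2 : K) = 0) :
    PolyDegeneratesTo (cwTensor K 2) (nurmiev K 3) ∧
    PolyDegeneratesTo (nurmiev K 3) (nurmiev K 6) ∧
    PolyDegeneratesTo (nurmiev K 6) (nurmiev K 7) :=
  ⟨cwTensor_two_polyDegeneratesTo_nurmiev_three_of_two_eq_zero K h2,
    (nullcone_three_covers_of_two_eq_zero K h2).2.1,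
    (nullcone_covers_ring K).2.2.2.2.2.2.2.1⟩

end Summit.MatrixMultiplication.MatrixMultiplication.Theorems.NullconeHasse
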